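import Summits.RiemannHypothesis.RiemannHypothesis.Theorems.SemilocalDeletionCliff
import Summits.RiemannHypothesis.RiemannHypothesis.Theorems.HandoffSemilocalEnergy
import Mathlib.MeasureTheory.Function.Floor
import HarnessLib

/-!
# Schur CELL CERTIFICATES for multi-prime deletions: a finite rational check ⇒ the orbit-graph floor

`SemilocalDeletionSchurFloor.re_weilSemilocalQuadratic_sdiff_ge_of_schur` turns any Schur weight `φ` of the lags `log p`
(`p ∈ D`) on the window `[−c, c]` into the floor `Re Q_{S∖D}(g) ≥ Re Q_S(g) − ρ‖g‖₂²`.  Seat handoff-idea-1 (gen14,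
CERT-SCHUR-idea1-g14) computes such weights as RATIONAL TABLES on `M` equal cells with rational enclosures of the lags; this
file is the kernel-side consumer: a certificate `SchurCellCert` (`c`, `M`, the table `phi`, bounds `phiMin, phiMax`, atoms
`(p, Llo, Lhi, whi)`, per-row CLAIMED index ranges of the cells that `x ± log p` can reach, `rho`), a Boolean `check` (pure `ℚ`
arithmetic, linear in `M`: the range claims are verified through their two boundary cells, so the `max` runs over ≤ 4 cells per
atom), the proposition `Valid` it establishes (`valid_of_check`; instances may also prove it row by row), the real step
weight `weight` (value `phi[i]` on cell `i`, `0` outside the window) with its cell-index bookkeeping (`cellIndex_spec`) and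
bounds (`weight_nonneg`, `weight_le`, `phiMin_le_weight`, `measurable_weight`).  SOUNDNESS — `Valid` + the enclosures
`Llo ≤ log p ≤ Lhi`, `log p/√p ≤ whi` ⇒ the pointwise Schur inequality for `weight` ⇒ the floor with constant `rho` — is the
sequel `SemilocalDeletionSchurCellsSound.lean`; instances (one data file per cell, `decide +kernel` on `check`) import that.

The only non-rational inputs an instance must supply are the enclosures of `log p` (tree: `SemilocalLogAtoms*`).  DEFINITIONS
of a certificate format and its checker; nothing here bears on RH.
-/

set_option linter.dupNamespace false

noncomputable section

open Complex Filter Set MeasureTheory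
open scoped Real Topology ComplexConjugate

namespace Summit.RiemannHypothesis.RiemannHypothesis.Theorems.SemilocalDeletionSchurCells

open Literature.NumberTheory.LFunctions
open Summit.RiemannHypothesis.RiemannHypothesis.Theorems.SemilocalDeletionCliff
open Summit.RiemannHypothesis.RiemannHypothesis.Theorems.HandoffSemilocalEnergy

/-- A rational Schur cell certificate: window `[−c, c]` cut into `M` equal cells, the weight table `phi` (cell values) with
declared bounds `phiMin ≤ phi[i] ≤ phiMax`, the deleted atoms `(p, Llo, Lhi, whi)` (prime, enclosure of `log p`, upper bound of
`log p/√p`), and the Schur constant `rho`. -/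
structure SchurCellCert where
  /-- half-width of the window -/
  c : ℚ
  /-- number of cells -/
  M : ℕ
  /-- the weight on each cell -/
  phi : List ℚ
  /-- a positive lower bound of the table -/
  phiMin : ℚ
  /-- an upper bound of the table -/
  phiMax : ℚ
  /-- the atoms `(p, Llo, Lhi, whi)` -/
  atoms : List (ℕ × ℚ × ℚ × ℚ)
  /-- per row `i` and per atom (same order as `atoms`): claimed index ranges `(jloP, jhiP, jloM, jhiM)` of the cells that can
  contain `x + L` (`P`) resp. `x − L` (`M`) for `x` in cell `i`; verified by `check`, only their being a SUPERSET matters -/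
  ranges : List (List (ℕ × ℕ × ℕ × ℕ))
  /-- the Schur constant -/
  rho : ℚ

namespace SchurCellCert

variable (C : SchurCellCert)

/-- The cell width `h = 2c/M`. -/
def h : ℚ := 2 * C.c / C.M

/-- Table lookup (junk `0` beyond the table). -/
def phiAt (i : ℕ) : ℚ := C.phi.getD i 0

/-- Cell `j` can contain `x + L` for some `x` in cell `i` and `L ∈ [Llo, Lhi]` (a rational superset test). -/
def meetsPlus (i j : ℕ) (Llo Lhi : ℚ) : Bool :=
  decide ((j : ℚ) * C.h ≤ ((i : ℚ) + 1) * C.h + Lhi) && decide ((i : ℚ) * C.h + Llo ≤ ((j : ℚ) + 1) * C.h)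

/-- Cell `j` can contain `x − L` for some `x` in cell `i` and `L ∈ [Llo, Lhi]`. -/
def meetsMinus (i j : ℕ) (Llo Lhi : ℚ) : Bool :=
  decide ((j : ℚ) * C.h ≤ ((i : ℚ) + 1) * C.h - Llo) && decide ((i : ℚ) * C.h - Lhi ≤ ((j : ℚ) + 1) * C.h)

/-- `max` of the table over a list of cell indices (`0` for the empty list). -/
def maxOver (l : List ℕ) : ℚ := l.foldr (fun j acc ↦ max (C.phiAt j) acc) 0

/-- `max` of the table over the half-open index range `[jlo, jhi)` (`0` if empty). -/
def maxRange (jlo jhi : ℕ) : ℚ := C.maxOver (List.range' jlo (jhi - jlo))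

/-- The claimed ranges of row `i` (junk `[]` beyond the table). -/
def rangesAt (i : ℕ) : List (ℕ × ℕ × ℕ × ℕ) := C.ranges.getD i []

/-- The range claim `(jloP, jhiP, jloM, jhiM)` (half-open ranges `[jlo, jhi)`) for atom `(p, Llo, Lhi, whi)` at row `i` is
CONSISTENT: every cell `j < M` meeting `I_i + [Llo, Lhi]` lies in `[jloP, jhiP)` and every cell meeting `I_i − [Llo, Lhi]` lies in
`[jloM, jhiM)` — checked through the two boundary cells only (the meeting sets are intervals: one defining inequality is
monotone in `j`, the other antitone). -/
def rangeOK (i : ℕ) (a : ℕ × ℚ × ℚ × ℚ) (r : ℕ × ℕ × ℕ × ℕ) : Bool :=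
  (decide (r.1 = 0) || !(decide ((i : ℚ) * C.h + a.2.1 ≤ ((r.1 - 1 : ℕ) : ℚ) * C.h + C.h))) &&
  (decide (C.M ≤ r.2.1) || !(decide ((r.2.1 : ℚ) * C.h ≤ ((i : ℚ) + 1) * C.h + a.2.2.1))) &&
  (decide (r.2.2.1 = 0) || !(decide ((i : ℚ) * C.h - a.2.2.1 ≤ ((r.2.2.1 - 1 : ℕ) : ℚ) * C.h + C.h))) &&
  (decide (C.M ≤ r.2.2.2) || !(decide ((r.2.2.2 : ℚ) * C.h ≤ ((i : ℚ) + 1) * C.h - a.2.1)))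

/-- The contribution of one atom to row `i`: `whi · (max over the minus range + max over the plus range)`. -/
def atomTerm (a : ℕ × ℚ × ℚ × ℚ) (r : ℕ × ℕ × ℕ × ℕ) : ℚ := a.2.2.2 * (C.maxRange r.2.2.1 r.2.2.2 + C.maxRange r.1 r.2.1)

/-- The left side of the Schur row `i`. -/
def rowLHS (i : ℕ) : ℚ := (List.zipWith (C.atomTerm) C.atoms (C.rangesAt i)).sum

/-- Row `i` of the certificate holds: the range claims are consistent and the Schur inequality of the row is satisfied. -/
def rowOK (i : ℕ) : Bool :=
  decide ((C.rangesAt i).length = C.atoms.length) &&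
    (List.zipWith (C.rangeOK i) C.atoms (C.rangesAt i)).all id && decide (C.rowLHS i ≤ C.rho * C.phiAt i)

/-- **The finite check** (pure rational arithmetic). -/
def check : Bool :=
  decide (0 < C.c) && decide (0 < C.M) && decide (C.phi.length = C.M) && decide (0 < C.phiMin) && decide (0 ≤ C.rho) &&
    C.phi.all (fun q ↦ decide (C.phiMin ≤ q) && decide (q ≤ C.phiMax)) &&
    C.atoms.all (fun a ↦ decide (0 ≤ a.2.2.2)) && (List.range C.M).all C.rowOK

/-- The scalar part of the check (everything except the rows). -/
def checkScalars : Bool :=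
  decide (0 < C.c) && decide (0 < C.M) && decide (C.phi.length = C.M) && decide (0 < C.phiMin) && decide (0 ≤ C.rho) &&
    C.phi.all (fun q ↦ decide (C.phiMin ≤ q) && decide (q ≤ C.phiMax)) && C.atoms.all (fun a ↦ decide (0 ≤ a.2.2.2))

/-- A CHUNK of the row check: rows `lo, …, lo + n − 1` (large certificates are checked chunk by chunk, each by its own
`decide +kernel`, and assembled by `valid_of_chunks`). -/
def checkRows (lo n : ℕ) : Bool := (List.range' lo n).all C.rowOK

/-- The deleted primes of the certificate. -/
def primes : Finset ℕ := (C.atoms.map Prod.fst).toFinset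

/-- The cell index of a point of the window. -/
def cellIndex (x : ℝ) : ℕ := min (C.M - 1) ⌊(x + C.c) / (C.h : ℝ)⌋₊

/-- The real step weight: `phi[cellIndex x]` on the window, `0` outside. -/
def weight (x : ℝ) : ℝ := if x ∈ Icc (-(C.c : ℝ)) C.c then (C.phiAt (C.cellIndex x) : ℝ) else 0

/-! ### Unpacking the check -/

/-- The content of a successful check, as a proposition (instances may establish it row by row instead of by one `decide`). -/
structure Valid (C : SchurCellCert) : Prop where
  c_pos : 0 < C.c
  M_pos : 0 < C.M
  len_eq : C.phi.length = C.M
  phiMin_pos : 0 < C.phiMin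
  rho_nonneg : 0 ≤ C.rho
  phi_mem : ∀ q ∈ C.phi, C.phiMin ≤ q ∧ q ≤ C.phiMax
  atoms_nonneg : ∀ a ∈ C.atoms, 0 ≤ a.2.2.2
  rows : ∀ i < C.M, C.rowOK i = true

variable {C}

/-- `check = true` establishes `Valid`. -/
theorem valid_of_check (hC : C.check = true) : C.Valid := by
  unfold check at hC
  simp only [Bool.and_eq_true, decide_eq_true_eq, List.all_eq_true, List.mem_range] at hC
  obtain ⟨⟨⟨⟨⟨⟨⟨hc, hM⟩, hlen⟩, hmin⟩, hrho⟩, hphi⟩, hat⟩, hrow⟩ := hC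
  exact ⟨hc, hM, hlen, hmin, hrho, hphi, hat, hrow⟩

/-- A checked chunk gives its rows. -/
theorem rowOK_of_checkRows {lo n i : ℕ} (h : C.checkRows lo n = true) (h1 : lo ≤ i) (h2 : i < lo + n) :
    C.rowOK i = true := by
  unfold checkRows at h
  rw [List.all_eq_true] at h
  exact h i (List.mem_range'_1.2 ⟨h1, h2⟩)

/-- **Chunked check ⇒ `Valid`**: the scalar part plus row chunks covering `0, …, M − 1` (given as a row-wise hypothesis, to be
discharged chunk by chunk with `rowOK_of_checkRows`). -/
theorem valid_of_chunks (hs : C.checkScalars = true) (hrows : ∀ i < C.M, C.rowOK i = true) : C.Valid := by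
  unfold checkScalars at hs
  simp only [Bool.and_eq_true, decide_eq_true_eq, List.all_eq_true] at hs
  obtain ⟨⟨⟨⟨⟨⟨hc, hM⟩, hlen⟩, hmin⟩, hrho⟩, hphi⟩, hat⟩ := hs
  exact ⟨hc, hM, hlen, hmin, hrho, hphi, hat, hrows⟩

/-- Unpacking one row. -/
theorem rowOK_spec {i : ℕ} (h : C.rowOK i = true) :
    (C.rangesAt i).length = C.atoms.length ∧
      (∀ ar ∈ List.zip C.atoms (C.rangesAt i), C.rangeOK i ar.1 ar.2 = true) ∧ C.rowLHS i ≤ C.rho * C.phiAt i := by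
  unfold rowOK at h
  simp only [Bool.and_eq_true, decide_eq_true_eq, List.all_eq_true, id] at h
  obtain ⟨⟨hlen, hall⟩, hle⟩ := h
  refine ⟨hlen, fun ar har ↦ ?_, hle⟩
  have : C.rangeOK i ar.1 ar.2 ∈ List.zipWith (C.rangeOK i) C.atoms (C.rangesAt i) := by
    rw [← List.map_uncurry_zip_eq_zipWith]
    exact List.mem_map.2 ⟨ar, har, rfl⟩
  exact hall _ this

/-- Table values inside the table are bracketed by `phiMin, phiMax`. -/
theorem phiAt_mem (hV : C.Valid) {i : ℕ} (hi : i < C.M) : C.phiMin ≤ C.phiAt i ∧ C.phiAt i ≤ C.phiMax := by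
  have hi' : i < C.phi.length := by rw [hV.len_eq]; exact hi
  have hmem : C.phiAt i ∈ C.phi := by
    unfold phiAt
    rw [List.getD_eq_getElem _ _ hi']
    exact List.getElem_mem hi'
  exact hV.phi_mem _ hmem

/-- `maxOver` dominates every listed table value and is nonnegative. -/
theorem le_maxOver {l : List ℕ} {j : ℕ} (hj : j ∈ l) : C.phiAt j ≤ C.maxOver l := by
  induction l with
  | nil => exact absurd hj List.not_mem_nil
  | cons k l ih =>
    unfold maxOver
    simp only [List.foldr_cons]
    rcases List.mem_cons.1 hj with rfl | h
    · exact le_max_left _ _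
    · exact (ih h).trans (le_max_right _ _)

/-- `maxOver` is nonnegative (the fold starts at `0`). -/
theorem maxOver_nonneg (l : List ℕ) : 0 ≤ C.maxOver l := by
  induction l with
  | nil => unfold maxOver; simp
  | cons k l ih => unfold maxOver at ih ⊢; simp only [List.foldr_cons]; exact ih.trans (le_max_right _ _)

/-- `maxRange jlo jhi` dominates the table on `[jlo, jhi)`. -/
theorem le_maxRange {jlo jhi j : ℕ} (h1 : jlo ≤ j) (h2 : j < jhi) : C.phiAt j ≤ C.maxRange jlo jhi :=
  C.le_maxOver (List.mem_range'_1.2 ⟨h1, by omega⟩)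

/-- `maxRange` is nonnegative. -/
theorem maxRange_nonneg (jlo jhi : ℕ) : 0 ≤ C.maxRange jlo jhi := C.maxOver_nonneg _

/-! ### The cell index -/

/-- The cell width is positive (real form). -/
theorem h_pos (hV : C.Valid) : (0 : ℝ) < C.h := by
  have hc := hV.c_pos; have hM := hV.M_pos
  unfold h; push_cast
  exact div_pos (by positivity) (by exact_mod_cast hM)

/-- The cell width is positive (rational form). -/
theorem h_pos_rat (hV : C.Valid) : (0 : ℚ) < C.h := by
  have hc := hV.c_pos; have hM := hV.M_pos
  unfold h
  exact div_pos (by positivity) (by exact_mod_cast hM)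

/-- `M·h = 2c`. -/
theorem M_mul_h (hV : C.Valid) : (C.M : ℝ) * C.h = 2 * C.c := by
  have hM := hV.M_pos
  unfold h; push_cast
  field_simp

/-- For `x` in the window with cell index `i`: `i < M` and `i·h ≤ x + c ≤ (i+1)·h`. -/
theorem cellIndex_spec (hV : C.Valid) {x : ℝ} (hx : x ∈ Icc (-(C.c : ℝ)) C.c) :
    C.cellIndex x < C.M ∧ (C.cellIndex x : ℝ) * C.h ≤ x + C.c ∧ x + C.c ≤ ((C.cellIndex x : ℝ) + 1) * C.h := by
  have hc := hV.c_pos; have hM := hV.M_pos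
  have hh := h_pos hV
  have hMh := M_mul_h hV
  rw [mem_Icc] at hx
  have hx0 : 0 ≤ x + C.c := by linarith
  have hfl := Nat.floor_le (div_nonneg hx0 hh.le)          -- ⌊t⌋₊ ≤ t
  have hlt := Nat.lt_floor_add_one ((x + C.c) / (C.h : ℝ))   -- t < ⌊t⌋₊ + 1
  unfold cellIndex
  by_cases hcase : ⌊(x + ↑C.c) / (C.h : ℝ)⌋₊ ≤ C.M - 1
  · rw [min_eq_right hcase]
    refine ⟨by omega, ?_, ?_⟩
    · have := (le_div_iff₀ hh).1 hfl; linarith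
    · have := (div_lt_iff₀ hh).1 hlt; linarith
  · push Not at hcase
    rw [min_eq_left hcase.le]
    have hMle : (C.M : ℝ) ≤ ⌊(x + ↑C.c) / (C.h : ℝ)⌋₊ := by exact_mod_cast (by omega : C.M ≤ ⌊(x + ↑C.c) / (C.h : ℝ)⌋₊)
    have h1 : (C.M : ℝ) * C.h ≤ x + C.c := by
      have := (le_div_iff₀ hh).1 (hMle.trans hfl); linarith
    refine ⟨by omega, ?_, ?_⟩
    · have : ((C.M - 1 : ℕ) : ℝ) = (C.M : ℝ) - 1 := by rw [Nat.cast_sub (by omega)]; simp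
      rw [this]; nlinarith
    · have : ((C.M - 1 : ℕ) : ℝ) + 1 = (C.M : ℝ) := by rw [Nat.cast_sub (by omega)]; push_cast; ring
      rw [this]; linarith

/-! ### The step weight -/

/-- On the window the weight is the table value of the cell. -/
theorem weight_of_mem {x : ℝ} (hx : x ∈ Icc (-(C.c : ℝ)) C.c) : C.weight x = C.phiAt (C.cellIndex x) := by
  unfold weight; rw [if_pos hx]

/-- Off the window the weight vanishes. -/
theorem weight_of_not_mem {x : ℝ} (hx : x ∉ Icc (-(C.c : ℝ)) C.c) : C.weight x = 0 := by
  unfold weight; rw [if_neg hx]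

/-- The weight is nonnegative. -/
theorem weight_nonneg (hV : C.Valid) (x : ℝ) : 0 ≤ C.weight x := by
  by_cases hx : x ∈ Icc (-(C.c : ℝ)) C.c
  · rw [weight_of_mem hx]
    have h1 := (phiAt_mem hV (cellIndex_spec hV hx).1).1
    have h2 := hV.phiMin_pos
    exact_mod_cast (h2.le.trans h1)
  · rw [weight_of_not_mem hx]

/-- The weight is bounded by `max phiMax 0`. -/
theorem weight_le (hV : C.Valid) (x : ℝ) : C.weight x ≤ max (C.phiMax : ℝ) 0 := by
  by_cases hx : x ∈ Icc (-(C.c : ℝ)) C.c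
  · rw [weight_of_mem hx]
    exact le_trans (by exact_mod_cast (phiAt_mem hV (cellIndex_spec hV hx).1).2) (le_max_left _ _)
  · rw [weight_of_not_mem hx]; exact le_max_right _ _

/-- On the window the weight is at least `phiMin`. -/
theorem phiMin_le_weight (hV : C.Valid) {x : ℝ} (hx : x ∈ Icc (-(C.c : ℝ)) C.c) : (C.phiMin : ℝ) ≤ C.weight x := by
  rw [weight_of_mem hx]; exact_mod_cast (phiAt_mem hV (cellIndex_spec hV hx).1).1

/-- The step weight is measurable. -/
theorem measurable_weight : Measurable C.weight := by
  unfold weight cellIndex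
  refine Measurable.ite measurableSet_Icc ?_ measurable_const
  have hf : Measurable fun x : ℝ ↦ min (C.M - 1) ⌊(x + C.c) / (C.h : ℝ)⌋₊ :=
    measurable_const.min ((measurable_id.add_const _).div_const _).nat_floor
  exact (measurable_from_nat (f := fun n : ℕ ↦ (C.phiAt n : ℝ))).comp hf

end SchurCellCert

end Summit.RiemannHypothesis.RiemannHypothesis.Theorems.SemilocalDeletionSchurCells

end
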